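import Mathlib
import Summits.PneNP.PneNP.Theses.ConvexRankGates
import Summits.PneNP.PneNP.Theorems.ConvexRankGatesThetaGateKillsRazborovPair

/-!
# Route ConvexRankGates — support item `XorUnsatIsOnePermGate` (stmt-PneNP-2664)

`Summit.PneNP.PneNP.Theses.ConvexRankGates.XorUnsatIsOnePermGate`: monotone XOR-UNSAT on
`n` variables — the input is a set of affine equations `a ⬝ᵥ y = b` over `𝔽₂` (one Boolean
variable per pair `(a, b) : (Fin n → ZMod 2) × ZMod 2`), the output says that the selected
system has no solution — is computed by a circuit consisting of ONE group-membership (PERM)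
gate on `2n + 2` points (Goos–Kamath–Robere–Sokolov 2019 use this monotone `NC²` function; the
gate model is the route's `PERM_s`).

Construction. Points `X = Option (Fin n) × ZMod 2` (`2n + 2` of them, transported to `Fin d`).
An equation `v = (a, b)` has coordinates `c_v : Option (Fin n) → ZMod 2` (`none ↦ b`,
`some i ↦ a i`) and acts on `X` by the translation `σ_v : (j, t) ↦ (j, t + c_v j)`
(`Equiv.prodCongrRight` of `Equiv.addRight`), a product of disjoint transpositions; `v ↦ σ_v` is
an injective homomorphism from the additive group `𝔽₂^{n+1}` into `Sym(X)`. The gate's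
permutations are the `σ_e`, its target is `τ = σ_{(0, 1)}`. Then
`τ ∈ ⟨σ_e : e selected⟩ ↔ (0, 1) ∈ span_{𝔽₂} {selected e}`
(`mem_closure_image_iff_mem_span`: both inclusions by closure/span induction) `↔` the selected
system is unsatisfiable (`zeroOne_mem_span_iff_xorUnsat`, the Fredholm alternative over the
field `𝔽₂`: a solution `y` gives the functional `(a, b) ↦ a ⬝ᵥ y - b` killing the span but not
`(0, 1)`; conversely a functional `f` killing the span with `f (0, 1) = 1`
(`Submodule.exists_dual_map_eq_bot_of_notMem`) yields the solution `y_i = f (e_i, 0)`).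

References: M. Göös, P. Kamath, R. Robere, D. Sokolov, *Adventures in monotone complexity and
TFNP*, ITCS 2019, §1 (monotone XOR-SAT / 𝔽₂-linear-system encoding); M. Furst, J. Hopcroft,
E. Luks, *Polynomial-time algorithms for permutation groups*, FOCS 1980 (membership testing).
-/

namespace Summit.PneNP.PneNP.Theorems

open Literature.Computability.Complexity

section XorUnsat

variable {n : ℕ}

/-- **Subgroup generated by an embedded `𝔽₂`-space.** If `φ` is an injective homomorphism from
the additive group of an `𝔽₂`-vector space `V` into a group `G`, then `φ v` lies in the subgroup
generated by `φ '' T` iff `v` lies in the `𝔽₂`-span of `T` (over `𝔽₂`, span = generated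
subgroup). [folklore] -/
theorem mem_closure_image_iff_mem_span {V G : Type*} [AddCommGroup V] [Module (ZMod 2) V]
    [Group G] (φ : V → G) (h0 : φ 0 = 1) (hadd : ∀ u v, φ (u + v) = φ u * φ v)
    (hinj : Function.Injective φ) (T : Set V) (v : V) :
    φ v ∈ Subgroup.closure (φ '' T) ↔ v ∈ Submodule.span (ZMod 2) T := by
  constructor
  · intro h
    -- every element of the generated subgroup is `φ` of an element of the span
    suffices H : ∀ g ∈ Subgroup.closure (φ '' T),
        ∃ u ∈ Submodule.span (ZMod 2) T, φ u = g by
      obtain ⟨u, hu, hug⟩ := H _ h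
      rwa [← hinj hug]
    intro g hg
    induction hg using Subgroup.closure_induction with
    | mem x hx =>
      obtain ⟨u, hu, rfl⟩ := hx
      exact ⟨u, Submodule.subset_span hu, rfl⟩
    | one => exact ⟨0, Submodule.zero_mem _, h0⟩
    | mul x y _ _ ihx ihy =>
      obtain ⟨u, hu, rfl⟩ := ihx
      obtain ⟨u', hu', rfl⟩ := ihy
      exact ⟨u + u', Submodule.add_mem _ hu hu', hadd u u'⟩
    | inv x _ ih =>
      obtain ⟨u, hu, rfl⟩ := ih
      refine ⟨-u, Submodule.neg_mem _ hu, ?_⟩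
      exact eq_inv_of_mul_eq_one_left (by rw [← hadd, neg_add_cancel, h0])
  · intro h
    induction h using Submodule.span_induction with
    | mem x hx => exact Subgroup.subset_closure ⟨x, hx, rfl⟩
    | zero => rw [h0]; exact Subgroup.one_mem _
    | add x y _ _ ihx ihy => rw [hadd]; exact Subgroup.mul_mem _ ihx ihy
    | smul c x _ ih =>
      have hc : ∀ c : ZMod 2, c = 0 ∨ c = 1 := by decide
      rcases hc c with rfl | rfl
      · rw [zero_smul, h0]; exact Subgroup.one_mem _
      · rwa [one_smul]

/-- **Fredholm alternative over `𝔽₂`.** A system `T` of affine equations `a ⬝ᵥ y = b` over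
`ZMod 2` has no solution iff `(0, 1)` lies in the `𝔽₂`-span of the augmented rows
`(a, b) ∈ T`. [folklore] -/
theorem zeroOne_mem_span_iff_xorUnsat (T : Set ((Fin n → ZMod 2) × ZMod 2)) :
    ((0 : Fin n → ZMod 2), (1 : ZMod 2)) ∈ Submodule.span (ZMod 2) T ↔
      ¬ ∃ y : Fin n → ZMod 2, ∀ e ∈ T, e.1 ⬝ᵥ y = e.2 := by
  constructor
  · rintro hmem ⟨y, hy⟩
    -- every vector of the span satisfies `v.1 ⬝ᵥ y = v.2`; `(0, 1)` does not
    have key : ∀ v ∈ Submodule.span (ZMod 2) T, v.1 ⬝ᵥ y = v.2 := by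
      intro v hv
      induction hv using Submodule.span_induction with
      | mem v hv => exact hy v hv
      | zero => simp
      | add u v _ _ hu hv => simp [add_dotProduct, hu, hv]
      | smul c v _ hv => simp [smul_dotProduct, hv]
    have h01 := key _ hmem
    rw [zero_dotProduct] at h01
    exact zero_ne_one h01
  · intro h
    by_contra hmem
    apply h
    obtain ⟨f, hf1, hfT⟩ := Submodule.exists_dual_map_eq_bot_of_notMem hmem inferInstance
    -- the functional `f` kills the span and has `f (0, 1) = 1`; read off the solution
    let g : (Fin n → ZMod 2) →ₗ[ZMod 2] ZMod 2 :=
      f ∘ₗ LinearMap.inl (ZMod 2) (Fin n → ZMod 2) (ZMod 2)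
    refine ⟨fun i => g (fun j => if i = j then 1 else 0), fun e he => ?_⟩
    have hfe : f e = 0 := by
      have : f e ∈ (Submodule.span (ZMod 2) T).map f :=
        Submodule.mem_map_of_mem (Submodule.subset_span he)
      rwa [hfT, Submodule.mem_bot] at this
    have hg : e.1 ⬝ᵥ (fun i => g (fun j => if i = j then 1 else 0)) = f (e.1, 0) := by
      have hsum := LinearMap.pi_apply_eq_sum_univ g e.1
      simp only [smul_eq_mul] at hsum
      rw [dotProduct, ← hsum]
      rfl
    have h1 : f (0, 1) = 1 := by
      have h01 : ∀ c : ZMod 2, c ≠ 0 → c = 1 := by decide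
      exact h01 _ hf1
    have hdecomp : f e = f (e.1, 0) + e.2 * f (0, 1) := by
      conv_lhs => rw [show e = (e.1, 0) + e.2 • ((0 : Fin n → ZMod 2), (1 : ZMod 2)) by
        ext <;> simp]
      rw [map_add, map_smul, smul_eq_mul]
    have hsum0 : f (e.1, 0) + e.2 = 0 := by
      rw [hdecomp, h1, mul_one] at hfe
      exact hfe
    rw [hg]
    calc f (e.1, 0) = -e.2 := eq_neg_of_add_eq_zero_left hsum0
      _ = e.2 := ZMod.neg_eq_self_mod_two _

/-- **`XorUnsatIsOnePermGate`** (route ConvexRankGates, stmt-PneNP-2664): monotone XOR-UNSAT on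
`n` variables is computed by a size-`1` circuit whose single gate is a PERM gate on `2n + 2`
points — the points are `Option (Fin n) × ZMod 2`, equation `e = (a, b)` acts by the translation
`σ_e : (j, t) ↦ (j, t + c_e j)` with `c_e none = b`, `c_e (some i) = a i` (a product of disjoint
transpositions), `τ = σ_{(0,1)}`, and: unsatisfiable `↔ (0, 1) ∈ span ↔ τ ∈ ⟨σ_e : e selected⟩`.
[cite: GoosKamathRobereSokolov2019, §1; FurstHopcroftLuks1980] -/
theorem xorUnsatIsOnePermGate_proof :
    Summit.PneNP.PneNP.Theses.ConvexRankGates.XorUnsatIsOnePermGate := by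
  unfold Summit.PneNP.PneNP.Theses.ConvexRankGates.XorUnsatIsOnePermGate
  dsimp only
  intro n
  classical
  -- enumeration of the input variables (all affine equations over `𝔽₂ⁿ`)
  let ι : Type := (Fin n → ZMod 2) × ZMod 2
  let N : ℕ := Fintype.card ι
  let w : Fin N → ι := (Fintype.equivFin ι).symm
  -- coordinates of an equation on the `n + 1` points `Option (Fin n)` (`none` = the RHS)
  let c : ι → Option (Fin n) → ZMod 2 := fun v j => j.elim v.2 v.1
  have c_add : ∀ u v, c (u + v) = c u + c v := fun u v => by
    funext j; cases j <;> rfl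
  have c_zero : c 0 = 0 := by
    funext j; cases j <;> rfl
  have c_inj : Function.Injective c := fun u v h =>
    Prod.ext (funext fun i => congr_fun h (some i)) (congr_fun h none)
  -- the `2n + 2` points and the translation action, transported to `Fin d`
  let sh : ι → Equiv.Perm (Option (Fin n) × ZMod 2) := fun v =>
    Equiv.prodCongrRight fun j => Equiv.addRight (c v j)
  have sh_zero : sh 0 = 1 := by
    ext p : 1
    obtain ⟨j, t⟩ := p
    simp [sh, c_zero]
  have sh_add : ∀ u v, sh (u + v) = sh u * sh v := fun u v => by
    ext p : 1
    obtain ⟨j, t⟩ := p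
    simp only [sh, c_add, Pi.add_apply, Equiv.Perm.mul_apply, Equiv.prodCongrRight_apply,
      Equiv.coe_addRight]
    refine Prod.ext rfl ?_
    ring
  have sh_inj : Function.Injective sh := fun u v h => by
    apply c_inj
    funext j
    have h1 := Equiv.congr_fun h (j, 0)
    simpa [sh] using h1
  let d : ℕ := Fintype.card (Option (Fin n) × ZMod 2)
  let eX : Option (Fin n) × ZMod 2 ≃ Fin d := Fintype.equivFin _
  let φ : ι → Equiv.Perm (Fin d) := fun v => eX.permCongrHom (sh v)
  have h0 : φ 0 = 1 := by
    show eX.permCongrHom (sh 0) = 1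
    rw [sh_zero, map_one]
  have hadd : ∀ u v, φ (u + v) = φ u * φ v := fun u v => by
    show eX.permCongrHom (sh (u + v)) = eX.permCongrHom (sh u) * eX.permCongrHom (sh v)
    rw [sh_add, map_mul]
  have hinj : Function.Injective φ := fun u v h => sh_inj (eX.permCongrHom.injective h)
  -- the gate: is `τ = φ (0,1)` in the subgroup generated by the selected `σ_i = φ (w i)`?
  let f : (Fin N → Bool) → Bool := fun u =>
    decide (φ (0, 1) ∈ Subgroup.closure ((fun i => φ (w i)) '' {i | u i = true}))
  obtain ⟨C, hCover, hCsize, hCeval⟩ := exists_oneGate_circuit N f w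
  refine ⟨C, hCover _ ⟨d, ?_, fun i => φ (w i), φ (0, 1), fun u => decide_eq_true_iff⟩,
    hCsize, fun x => ?_⟩
  · -- `d = 2n + 2`
    show Fintype.card (Option (Fin n) × ZMod 2) ≤ 2 * n + 2
    simp only [Fintype.card_prod, Fintype.card_option, Fintype.card_fin, ZMod.card]
    omega
  · rw [hCeval]
    simp only [f, decide_eq_decide]
    -- the selected generators are `φ '' {e | x e}`
    have himg : (fun i => φ (w i)) '' {i | x (w i) = true} = φ '' {e | x e = true} := by
      ext g
      constructor
      · rintro ⟨i, hi, rfl⟩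
        exact ⟨w i, hi, rfl⟩
      · rintro ⟨e, he, rfl⟩
        refine ⟨Fintype.equivFin ι e, ?_, ?_⟩
        · show x (w (Fintype.equivFin ι e)) = true
          simpa [w] using he
        · show φ (w (Fintype.equivFin ι e)) = φ e
          simp [w]
    rw [himg, mem_closure_image_iff_mem_span φ h0 hadd hinj, zeroOne_mem_span_iff_xorUnsat]
    rfl

end XorUnsat

end Summit.PneNP.PneNP.Theorems
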